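import Mathlib
import Summits.PneNP.PneNP.Theorems.Nc03AvoidResidualCoreReductionSolveKit
import Summits.PneNP.PneNP.Theorems.Nc03AvoidResidualCoreReductionNPN
import Literature.Computability.Complexity.CodeFPStringKit
import Literature.Computability.Complexity.CodeFPStrings
import Literature.Computability.Complexity.CookBridges

/-!
# Route Nc03AvoidResidualCore, item `ResidualCoreReduction` — the solver, XVI: class `13` (`CAND`) via the oracle

Helper file for `stmt-PneNP-20227` (cell pnp-ideate). The one class the reduction does not solve
itself: pure `CAND` instances are handed to the hypothesised polynomial-time function `f₀` of
`CandAvoidLinearFP`. From the raw pure instance we rebuild the input code `LocalMap.encode J` of the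
relaxed bucket (`unparse`; `unparse_rawOf`), apply `f₀`, and read its first `M` bits (`sol13`). If
`f₀` avoids the range of every pure `CAND` instance with `0 < N`, `C₀ N ≤ M`, then so does `sol13 f₀`
(`sol13_correct`); and `sol13 f₀` is polynomial time when `f₀` is (`codeFP_sol13`).
-/

set_option linter.dupNamespace false -- `Summit.PneNP.PneNP.…`: summit = sub-problem name (D-0017 single-conjunct layout)

namespace Summit.PneNP.PneNP.Theorems.Nc03Reduction

open Literature.Computability.Complexity CodeFP

variable {N M : ℕ}

/-- The table byte of `CAND`. -/
def candByte : List Bool := List.ofFn fun p : Fin 8 => candPred fun i : Fin 3 => p.val.testBit i.val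

/-- The record string of a pure `CAND` output with variables `(a, b, c)` below `N` (capped). -/
def candRec (N : ℕ) (t : ℕ × ℕ × ℕ) : List Bool :=
  candByte ++ (ones (min t.1 N) ++ false :: (ones (min t.2.1 N) ++ false :: (ones (min t.2.2 N) ++ [false])))

/-- The input code of the pure `CAND` instance with the given raw form. -/
def unparse (pr : PRaw) : List Bool :=
  ones pr.1 ++ false :: (ones pr.2.1 ++ false :: (pr.2.2.map (candRec pr.1)).flatten)

/-- Solver, class `13`: the first `M` bits of the oracle's answer on the rebuilt code. -/
def sol13 (f₀ : List Bool → List Bool) (pr : PRaw) : List Bool :=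
  (List.range pr.2.1).map fun p => (f₀ (unparse pr)).getD p false

/-- Output length, class `13`. -/
@[simp] theorem length_sol13 (f₀ : List Bool → List Bool) (pr : PRaw) : (sol13 f₀ pr).length = pr.2.1 := by
  simp [sol13]

/-- **The rebuilt code is the input code** of a pure `CAND` instance. -/
theorem unparse_rawOf (J : LocalMap 3 N M) (hP : J.IsPure candPred) : unparse (rawOf J) = J.encode := by
  rw [encode_eq, rawOf_eq]
  unfold unparse
  simp only [List.map_ofFn]
  have hfun : (candRec N ∘ tripOf J) = fun j => recStr (recOf J j) := by
    funext p
    simp only [Function.comp_apply, candRec, recStr, recOf, tripOf, candByte, hP.1 p]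
    have h0 := (J.vars p 0).isLt; have h1 := (J.vars p 1).isLt; have h2 := (J.vars p 2).isLt
    rw [min_eq_left (le_of_lt h0), min_eq_left (le_of_lt h1), min_eq_left (le_of_lt h2)]
  rw [hfun]

/-- **Correctness, class `13`**, relative to the oracle. -/
theorem sol13_correct {f₀ : List Bool → List Bool} {C₀ : ℕ}
    (hf₀ : ∀ N M (J : LocalMap 3 N M), J.IsPure candPred → 0 < N → C₀ * N ≤ M → readOut M (f₀ J.encode) ∉ J.range)
    (J : LocalMap 3 N M) (hP : J.IsPure (rep 13)) (hN : 0 < N) (hM : C₀ * N ≤ M) :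
    (fun p : Fin M => (sol13 f₀ (rawOf J)).getD p.val false) ∉ J.range := by
  rw [rep_thirteen] at hP
  have h := hf₀ N M J hP hN hM
  have e : (fun p : Fin M => (sol13 f₀ (rawOf J)).getD p.val false) = readOut M (f₀ J.encode) := by
    funext p
    unfold sol13 readOut
    rw [rawOf_M, List.getD_eq_getElem?_getD, List.getElem?_map, List.getElem?_range p.isLt, unparse_rawOf J hP]
    rfl
  rw [e]; exact h

/-! ## Polynomial time -/

/-- The record string is polynomial time (in `N` unary and the triple). -/
theorem codeFP_candRec : CodeFP (pairE unE tripE) strE (fun q => candRec q.1 q.2) := by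
  have hu : ∀ {f : ℕ × (ℕ × ℕ × ℕ) → ℕ}, CodeFP (pairE unE tripE) natE f →
      CodeFP (pairE unE tripE) strE (fun q => ones (min (f q) q.1)) := by
    intro f hf
    exact (strOfUn.comp (unOfNatMin.comp ((fst _ _).pair hf))).congr fun q => by
      show unE (min (f q) q.1) = ones (min (f q) q.1); rw [unE_eq_ones]
  have ha := hu (snd _ _).fst'
  have hb := hu (snd _ _).snd'.fst'
  have hc := hu (snd _ _).snd'.snd'
  have hcb : CodeFP (pairE unE tripE) strE (fun _ => candByte) := const _ candByte
  have t3 : CodeFP (pairE unE tripE) strE (fun q => ones (min q.2.2.2 q.1) ++ [false]) :=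
    (strAppend.comp (hc.pair (const _ [false]))).congr fun _ => rfl
  have t2 : CodeFP (pairE unE tripE) strE (fun q => ones (min q.2.2.1 q.1) ++ false :: (ones (min q.2.2.2 q.1) ++ [false])) :=
    (strAppend.comp (hb.pair (consBit.comp ((const _ false).pair t3)))).congr fun _ => rfl
  have t1 : CodeFP (pairE unE tripE) strE
      (fun q => ones (min q.2.1 q.1) ++ false :: (ones (min q.2.2.1 q.1) ++ false :: (ones (min q.2.2.2 q.1) ++ [false]))) :=
    (strAppend.comp (ha.pair (consBit.comp ((const _ false).pair t2)))).congr fun _ => rfl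
  exact (strAppend.comp (hcb.pair t1)).congr fun _ => rfl

/-- The rebuilt code is polynomial time. -/
theorem codeFP_unparse : CodeFP prE strE unparse := by
  have hrecs : CodeFP prE (rawE strE) (fun pr => pr.2.2.map (candRec pr.1)) :=
    ((map (σ := ℕ) (eσ := unE) (g := fun q => candRec q.1 q.2) codeFP_candRec).comp
      (codeFP_N.pair codeFP_trips)).congr fun _ => rfl
  have hbody : CodeFP prE strE (fun pr => (pr.2.2.map (candRec pr.1)).flatten) := strFlatten.comp hrecs
  have hN : CodeFP prE strE (fun pr => ones pr.1) := (strOfUn.comp codeFP_N).congr fun pr => by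
    show unE pr.1 = ones pr.1; rw [unE_eq_ones]
  have hM : CodeFP prE strE (fun pr => ones pr.2.1) := (strOfUn.comp codeFP_M).congr fun pr => by
    show unE pr.2.1 = ones pr.2.1; rw [unE_eq_ones]
  have h2 : CodeFP prE strE (fun pr => ones pr.2.1 ++ false :: (pr.2.2.map (candRec pr.1)).flatten) :=
    (strAppend.comp (hM.pair (consBit.comp ((const _ false).pair hbody)))).congr fun _ => rfl
  exact (strAppend.comp (hN.pair (consBit.comp ((const _ false).pair h2)))).congr fun _ => rfl

/-- **Polynomial time, class `13`**, relative to a polynomial-time oracle. -/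
theorem codeFP_sol13 {f₀ : List Bool → List Bool} (hf₀ : IsPolyTime f₀) : CodeFP prE (rawE bitE) (sol13 f₀) := by
  have hF : CodeFP strE strE f₀ := of_fn f₀ ((CookBridges.isPolyTime_iff f₀).1 hf₀) fun _ => rfl
  have hw : CodeFP prE strE (fun pr => f₀ (unparse pr)) := hF.comp codeFP_unparse
  have hi : CodeFP (pairE prE natE) bitE (fun y => (f₀ (unparse y.1)).getD y.2 false) :=
    (CodeFP.strGetDNat.comp ((hw.comp (fst _ _)).pair (snd _ _))).congr fun _ => rfl
  exact ((map hi).comp ((CodeFP.id _).pair (urange.comp codeFP_M))).congr fun _ => rfl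

end Summit.PneNP.PneNP.Theorems.Nc03Reduction
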